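import Summits.MatrixMultiplication.OmegaCensus.SmallFormats.MatMul22nRankGF7Slack5Search
import HarnessLib

/-!
# ω-census family (a): replay of the slack-5 search certificate, CHECK A part 1 of 12 (elements `0 ≤ h < 28`)

Cell `pub-omega` (unit `pub-omega-tensor-g16`), topic `Summits/MatrixMultiplication/OmegaCensus` (sub-folder `SmallFormats`).
Framing (verbatim): lottery ticket; floor = certified bounds/negative ranges. HONEST FRAMING: machine-generated kernel replay
(`pub-omega-tensor-g16/code/gen5_runs.py`): `levelsOK5n h = true` for the elements `0 ≤ h < 28` of `PGL₂(7)`: for every slot `(c, h)`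
(`c < 656`) and bucket level, if the key of its column is visited then the bucket holds an entry with that column (SIMD key planes,
`MatMul22nRankGF7Plane`). Meaning: `slotOK5_of_levelsOK5` (`MatMul22nRankGF7Slack5SearchSound`). Nothing here is progress on `ω`.
-/

namespace Summit.MatrixMultiplication.OmegaCensus.SmallFormats

set_option Elab.async false

set_option maxRecDepth 100000 in
set_option maxHeartbeats 400000000 in
/-- Elements `0 ≤ h < 4`. -/
theorem levelsOK5_ok_0_4 : ∀ h : Fin 336, 0 ≤ h.val → h.val < 4 → levelsOK5n h.val = true := by decide +kernel

set_option maxRecDepth 100000 in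
set_option maxHeartbeats 400000000 in
/-- Elements `4 ≤ h < 8`. -/
theorem levelsOK5_ok_4_8 : ∀ h : Fin 336, 4 ≤ h.val → h.val < 8 → levelsOK5n h.val = true := by decide +kernel

set_option maxRecDepth 100000 in
set_option maxHeartbeats 400000000 in
/-- Elements `8 ≤ h < 12`. -/
theorem levelsOK5_ok_8_12 : ∀ h : Fin 336, 8 ≤ h.val → h.val < 12 → levelsOK5n h.val = true := by decide +kernel

set_option maxRecDepth 100000 in
set_option maxHeartbeats 400000000 in
/-- Elements `12 ≤ h < 16`. -/
theorem levelsOK5_ok_12_16 : ∀ h : Fin 336, 12 ≤ h.val → h.val < 16 → levelsOK5n h.val = true := by decide +kernel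

set_option maxRecDepth 100000 in
set_option maxHeartbeats 400000000 in
/-- Elements `16 ≤ h < 20`. -/
theorem levelsOK5_ok_16_20 : ∀ h : Fin 336, 16 ≤ h.val → h.val < 20 → levelsOK5n h.val = true := by decide +kernel

set_option maxRecDepth 100000 in
set_option maxHeartbeats 400000000 in
/-- Elements `20 ≤ h < 24`. -/
theorem levelsOK5_ok_20_24 : ∀ h : Fin 336, 20 ≤ h.val → h.val < 24 → levelsOK5n h.val = true := by decide +kernel

set_option maxRecDepth 100000 in
set_option maxHeartbeats 400000000 in
/-- Elements `24 ≤ h < 28`. -/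
theorem levelsOK5_ok_24_28 : ∀ h : Fin 336, 24 ≤ h.val → h.val < 28 → levelsOK5n h.val = true := by decide +kernel

/-- CHECK A for the elements `0 ≤ h < 28`. -/
theorem levelsOK5_run_1 : ∀ h : Fin 336, 0 ≤ h.val → h.val < 28 → levelsOK5n h.val = true := by
  intro h _hlo hhi
  by_cases h4 : h.val < 4
  · exact levelsOK5_ok_0_4 h (by omega) h4
  by_cases h8 : h.val < 8
  · exact levelsOK5_ok_4_8 h (by omega) h8
  by_cases h12 : h.val < 12
  · exact levelsOK5_ok_8_12 h (by omega) h12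
  by_cases h16 : h.val < 16
  · exact levelsOK5_ok_12_16 h (by omega) h16
  by_cases h20 : h.val < 20
  · exact levelsOK5_ok_16_20 h (by omega) h20
  by_cases h24 : h.val < 24
  · exact levelsOK5_ok_20_24 h (by omega) h24
  exact levelsOK5_ok_24_28 h (by omega) hhi

end Summit.MatrixMultiplication.OmegaCensus.SmallFormats
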